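import Literature.Geometry.Symplectic.OrigamiCutPieceForm
import HarnessLib

/-!
# The blow-down map of a cut piece and its centre

Proofs companion of `OrigamiUnfolding.lean` (the named fact
`Literature.Geometry.Symplectic.exists_symplecticCutPieces_of_isOrigamiForm`, Cannas da
Silva–Guillemin–Pires, *Symplectic Origami*, IMRN 2011 = arXiv:0909.4065, Prop. 2.8 with Def. 2.13
and the proof of Prop. 2.26), step (S4): for the setting `D : CutCollarData M N` and its cut piece
`D.Piece = V ∪_glue cutDisc δ` (`OrigamiCutGlue*.lean`), the **centre** `D.centre : N/S¹ → Piece`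
(the zero section of the disc bundle, "the natural embedding of `B`") and the **blow-down**
`D.blowDown : M → Piece` — `inV` on `V`, `x = c (n, t) ↦ inB [n, t]` on the whole band
`c (N × (-δ, δ))` (the blow-up model `β` of Def. 2.13 in the tree's coordinates; the two agree on
the overlap by the gluing relation).  We prove the clauses of the fact: `blowDown` is `C^∞` on
the open neighbourhood `V ∪ c(band)` of `closure V` (`contMDiffOn_blowDown`), injective on `V`
with `blowDown '' V = (range centre)ᶜ` and bijective differential there, it pulls the glued form
back to `s` on `V` (`pieceForm_blowDown_apply`), and it maps the fold image `c (N × {0})` onto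
`range centre` (`image_blowDown_zero`).  The corank of `d(blowDown)` along the fold, the embedding
and the symplectic property of the centre are in the sequel `OrigamiCutCentre.lean`.

Everything here is proved; the definitions are explicit; no facts.

## References

* A. Cannas da Silva, V. Guillemin, A. R. Pires, *Symplectic Origami*, IMRN 2011 =
  arXiv:0909.4065, Prop. 2.8, Def. 2.13, proof of Prop. 2.26. [CannasdasilvaGuilleminPires2010]
-/

noncomputable section

open scoped Manifold ContDiff Topology
open Set Function Filter TopologicalSpace
open _root_.Topology
open Literature.Geometry.Kaehler Literature.Geometry.Manifold

namespace Literature.Geometry.Symplectic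

namespace CutCollarData

universe u

variable {M : Type u} [TopologicalSpace M] [ChartedSpace (EuclideanSpace ℝ (Fin 4)) M]
  [IsManifold (𝓡 4) ∞ M]
  {N : Type} [TopologicalSpace N] [ChartedSpace (EuclideanSpace ℝ (Fin 3)) N]
  [IsManifold (𝓡 3) ∞ N] [T2Space N] [Nonempty N] [MulAction Circle N] (D : CutCollarData M N)

/-! ### The centre -/

omit [IsManifold (𝓡 4) ∞ M] [IsManifold (𝓡 3) ∞ N] [T2Space N] [Nonempty N] in
/-- The zero section lands in the disc bundle. [folklore] -/
theorem cutZero_mem_B (y : CircleQuotient N) : cutZero (k := 3) y ∈ (D.B : Set (CutSpace 3 N)) := by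
  obtain ⟨n, rfl⟩ := circleQuotientMk_surjective y
  show cutNormSq (cutZero (k := 3) (circleQuotientMk n)) < D.δ ^ 2
  rw [cutZero_mk, cutNormSq_cutMk, norm_zero, zero_pow two_ne_zero]
  exact pow_pos D.δ_pos 2

/-- The zero section as a map into the disc bundle. [folklore] -/
def zeroB (y : CircleQuotient N) : D.B := ⟨cutZero y, D.cutZero_mem_B y⟩

/-- **The centre** `B = N/S¹ ↪ M₀` of the cut piece (the image of the zero section).
[cite: CannasdasilvaGuilleminPires2010, Prop. 2.8] -/
def centre (y : CircleQuotient N) : D.Piece := D.inB (D.zeroB y)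

omit [IsManifold (𝓡 4) ∞ M] [IsManifold (𝓡 3) ∞ N] [T2Space N] [Nonempty N] in
/-- The value of `zeroB`. [folklore] -/
@[simp] theorem coe_zeroB (y : CircleQuotient N) : (D.zeroB y : CutSpace 3 N) = cutZero y := rfl

/-- The value of `centre`. [folklore] -/
theorem centre_apply (y : CircleQuotient N) : D.centre y = D.inB (D.zeroB y) := rfl

omit [IsManifold (𝓡 4) ∞ M] [IsManifold (𝓡 3) ∞ N] [T2Space N] [Nonempty N] in
/-- `zeroB` is injective. [folklore] -/
theorem zeroB_injective : Injective D.zeroB := fun _ _ h =>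
  injective_cutZero (congrArg Subtype.val h)

/-- The centre map is injective. [folklore] -/
theorem centre_injective : Injective D.centre := fun _ _ h =>
  D.zeroB_injective (D.inB_injective h)

omit [IsManifold (𝓡 4) ∞ M] [IsManifold (𝓡 3) ∞ N] [T2Space N] [Nonempty N] in
/-- The zero section misses the target of the gluing. [folklore] -/
theorem zeroB_not_mem_target (y : CircleQuotient N) : D.zeroB y ∉ D.glueTarget := by
  obtain ⟨n, rfl⟩ := circleQuotientMk_surjective y
  intro h
  apply h
  show cutNormSq (cutZero (k := 3) (circleQuotientMk n)) = 0
  rw [cutZero_mk, cutNormSq_cutMk, norm_zero, zero_pow two_ne_zero]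

omit [IsManifold (𝓡 4) ∞ M] [IsManifold (𝓡 3) ∞ N] [T2Space N] [Nonempty N] in
/-- A point of the disc bundle off the target is on the zero section. [folklore] -/
theorem exists_zeroB_of_not_mem_target {b : D.B} (hb : b ∉ D.glueTarget) : ∃ y, D.zeroB y = b := by
  have h0 : cutNormSq (b : CutSpace 3 N) = 0 := by
    by_contra h; exact hb h
  have hr : (b : CutSpace 3 N) ∈ range (cutZero : CircleQuotient N → CutSpace 3 N) := by
    rw [range_cutZero]; exact h0
  obtain ⟨y, hy⟩ := hr
  exact ⟨y, Subtype.ext hy⟩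

/-- **The centre misses the image of `V`.** [folklore] -/
theorem centre_ne_inV (y : CircleQuotient N) (a : D.V) : D.centre y ≠ D.inV a := by
  intro h
  obtain ⟨hsrc, hglue⟩ := D.inV_eq_inB_iff.1 h.symm
  exact D.zeroB_not_mem_target y (hglue ▸ D.glueFun_mem_target hsrc)

/-- On the target, `inV (unglue b) = inB b`. [folklore] -/
theorem inV_unglueFun {b : D.B} (hb : b ∈ D.glueTarget) : D.inV (D.unglueFun b) = D.inB b := by
  letI := D.csB; exact D.glueData.inl_glue_symm hb

/-! ### The side read in `V` -/

open Classical in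
/-- The corestriction `M → V` (junk off `V`). [folklore] -/
def mkV (x : M) : D.V := if h : x ∈ (D.V : Set M) then ⟨x, h⟩ else Classical.arbitrary D.V

omit [IsManifold (𝓡 4) ∞ M] [IsManifold (𝓡 3) ∞ N] [T2Space N] in
/-- The value of `mkV` on `V`. [folklore] -/
theorem mkV_of_mem {x : M} (hx : x ∈ (D.V : Set M)) : D.mkV x = ⟨x, hx⟩ := by
  classical
  exact dif_pos hx

omit [IsManifold (𝓡 4) ∞ M] [IsManifold (𝓡 3) ∞ N] [T2Space N] in
/-- `mkV a = a` for `a : V`. [folklore] -/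
@[simp] theorem mkV_coe (a : D.V) : D.mkV (a : M) = a := by
  rw [D.mkV_of_mem a.2]

omit [IsManifold (𝓡 4) ∞ M] [IsManifold (𝓡 3) ∞ N] [T2Space N] in
/-- `mkV` is `C^∞` on `V`. [folklore] -/
theorem contMDiffOn_mkV : ContMDiffOn (𝓡 4) (𝓡 4) ∞ D.mkV (D.V : Set M) := by
  have h : ContMDiffOn (𝓡 4) (𝓡 4) ∞ (Subtype.val ∘ D.mkV) (D.V : Set M) :=
    contMDiffOn_id.congr fun x hx => by
      show ((D.mkV x : D.V) : M) = x
      rw [D.mkV_of_mem hx]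
  intro x hx
  exact (ContMDiffWithinAt.subtypeVal_comp_iff D.V D.mkV _ x).1 (h x hx)

omit [IsManifold (𝓡 4) ∞ M] [IsManifold (𝓡 3) ∞ N] [T2Space N] in
/-- **The differential of `mkV` on `V` is the identity** (`T_x V = T_x M`). [folklore] -/
theorem mfderiv_mkV {x : M} (hx : x ∈ (D.V : Set M)) :
    mfderiv (𝓡 4) (𝓡 4) D.mkV x = ContinuousLinearMap.id ℝ (EuclideanSpace ℝ (Fin 4)) := by
  have hd : MDifferentiableAt (𝓡 4) (𝓡 4) D.mkV x :=
    (D.contMDiffOn_mkV.contMDiffAt (D.V.isOpen.mem_nhds hx)).mdifferentiableAt (by simp)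
  have hval : HasMFDerivAt (𝓡 4) (𝓡 4) (Subtype.val : D.V → M) (D.mkV x)
      (ContinuousLinearMap.id ℝ (EuclideanSpace ℝ (Fin 4))) :=
    OpenSubmanifold.hasMFDerivAt_subtype_val _
  have hcomp : mfderiv (𝓡 4) (𝓡 4) (Subtype.val ∘ D.mkV) x =
      (ContinuousLinearMap.id ℝ (EuclideanSpace ℝ (Fin 4))).comp (mfderiv (𝓡 4) (𝓡 4) D.mkV x) :=
    (hval.comp x hd.hasMFDerivAt).mfderiv
  have hev : (Subtype.val ∘ D.mkV) =ᶠ[𝓝 x] id := by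
    filter_upwards [D.V.isOpen.mem_nhds hx] with y hy
    show ((D.mkV y : D.V) : M) = y
    rw [D.mkV_of_mem hy]
  rw [hev.mfderiv_eq, mfderiv_id, ContinuousLinearMap.id_comp] at hcomp
  exact hcomp.symm

/-! ### The blow-down -/

/-- The symmetric clamp: `t` itself on `(-δ, δ)`, `0` otherwise. [folklore] -/
def clampSym (t : ℝ) : ℝ := if t ∈ Ioo (-D.δ) D.δ then t else 0

omit [IsManifold (𝓡 4) ∞ M] [IsManifold (𝓡 3) ∞ N] [T2Space N] [Nonempty N] in
/-- The symmetric clamp lies in `(-δ, δ)`. [folklore] -/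
theorem clampSym_mem (t : ℝ) : D.clampSym t ∈ Ioo (-D.δ) D.δ := by
  unfold clampSym; split_ifs with h
  · exact h
  · exact ⟨by linarith [D.δ_pos], D.δ_pos⟩

omit [IsManifold (𝓡 4) ∞ M] [IsManifold (𝓡 3) ∞ N] [T2Space N] [Nonempty N] in
/-- On `(-δ, δ)` the symmetric clamp is the identity. [folklore] -/
theorem clampSym_of_mem {t : ℝ} (ht : t ∈ Ioo (-D.δ) D.δ) : D.clampSym t = t := if_pos ht

omit [IsManifold (𝓡 4) ∞ M] [IsManifold (𝓡 3) ∞ N] [T2Space N] [Nonempty N] in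
/-- `[n, clampSym t]` lies in the disc bundle. [folklore] -/
theorem cutSlice_clampSym_mem (n : N) (t : ℝ) :
    cutSlice (k := 3) (n, D.clampSym t) ∈ (D.B : Set (CutSpace 3 N)) := by
  show cutNormSq (cutSlice (k := 3) (n, D.clampSym t)) < D.δ ^ 2
  rw [cutNormSq_cutSlice]
  have h := D.clampSym_mem t
  exact sq_lt_sq' h.1 h.2

/-- The band parameters read through the clamp: `x = c (n, t) ↦ (n, t)` on the band image.
[folklore] -/
def bandParam (x : M) : N × ℝ := ((D.cInv x).1, D.clampSym (D.cInv x).2)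

/-- The band read in the disc bundle: `x = c (n, t) ↦ [n, t]`. [folklore] -/
def bandB (x : M) : D.B := ⟨cutSlice (D.bandParam x), D.cutSlice_clampSym_mem _ _⟩

omit [IsManifold (𝓡 4) ∞ M] [IsManifold (𝓡 3) ∞ N] [T2Space N] in
/-- The value of `bandParam` at a band point. [folklore] -/
theorem bandParam_c {p : N × ℝ} (hp : p ∈ D.band) : D.bandParam (D.c p) = p := by
  show ((D.cInv (D.c p)).1, D.clampSym (D.cInv (D.c p)).2) = p
  rw [D.cInv_c hp, D.clampSym_of_mem hp.2]

omit [IsManifold (𝓡 4) ∞ M] [IsManifold (𝓡 3) ∞ N] [T2Space N] in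
/-- On the band image `bandParam = cInv`. [folklore] -/
theorem bandParam_of_mem {x : M} (hx : x ∈ D.c '' D.band) : D.bandParam x = D.cInv x := by
  obtain ⟨p, hp, rfl⟩ := hx
  rw [D.bandParam_c hp, D.cInv_c hp]

omit [IsManifold (𝓡 4) ∞ M] [IsManifold (𝓡 3) ∞ N] [T2Space N] in
/-- The value of `bandB`. [folklore] -/
theorem coe_bandB (x : M) : (D.bandB x : CutSpace 3 N) = cutSlice (D.bandParam x) := rfl

omit [IsManifold (𝓡 4) ∞ M] [IsManifold (𝓡 3) ∞ N] [T2Space N] in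
/-- The value of `bandB` at a band point. [folklore] -/
theorem coe_bandB_c {p : N × ℝ} (hp : p ∈ D.band) : (D.bandB (D.c p) : CutSpace 3 N) = cutSlice p := by
  rw [coe_bandB, D.bandParam_c hp]

open Classical in
/-- **The blow-down** `M → M₀`: `x = c (n, t) ↦ inB [n, t]` on the band, `inV x` on `V`
(junk elsewhere). [cite: CannasdasilvaGuilleminPires2010, Def. 2.13] -/
def blowDown (x : M) : D.Piece :=
  if x ∈ D.c '' D.band then D.inB (D.bandB x) else D.inV (D.mkV x)

/-- On the band the blow-down is `inB ∘ bandB`. [folklore] -/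
theorem blowDown_of_mem_band {x : M} (hx : x ∈ D.c '' D.band) : D.blowDown x = D.inB (D.bandB x) := by
  classical
  exact if_pos hx

omit [IsManifold (𝓡 4) ∞ M] [IsManifold (𝓡 3) ∞ N] [T2Space N] [Nonempty N] in
/-- `(n, 0)` lies in the band. [folklore] -/
theorem zero_mem_band (n : N) : (n, (0 : ℝ)) ∈ D.band :=
  D.mk_mem_band ⟨by linarith [D.δ_pos], D.δ_pos⟩

/-- **On `V` the blow-down is `inV`** (on the overlap with the band the two definitions agree by
the gluing relation). [folklore] -/
theorem blowDown_of_mem_V {x : M} (hx : x ∈ (D.V : Set M)) : D.blowDown x = D.inV ⟨x, hx⟩ := by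
  classical
  by_cases hb : x ∈ D.c '' D.band
  · rw [D.blowDown_of_mem_band hb]
    obtain ⟨⟨n, t⟩, hnt, rfl⟩ := hb
    have htpos : 0 < t := by
      by_contra h; push Not at h
      exact D.c_not_mem n t ⟨hnt.2.1, h⟩ hx
    have ht : t ∈ Ioo 0 D.δ := ⟨htpos, hnt.2.2⟩
    have hsrc : (⟨D.c (n, t), hx⟩ : D.V) ∈ D.glueSource := ⟨(n, t), D.mk_mem_halfBand ht, rfl⟩
    rw [← D.inB_glueFun hsrc]
    congr 1
    apply Subtype.ext
    rw [D.coe_bandB_c hnt, D.glueFun_apply ht hx]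
  · unfold blowDown
    rw [if_neg hb, D.mkV_of_mem hx]

/-- On `V` the blow-down is `inV ∘ mkV`. [folklore] -/
theorem blowDown_eq_inV_mkV {x : M} (hx : x ∈ (D.V : Set M)) : D.blowDown x = D.inV (D.mkV x) := by
  rw [D.blowDown_of_mem_V hx, D.mkV_of_mem hx]

/-- **The blow-down at a fold point is the centre**: `blowDown (c (n, 0)) = centre [n]`. [folklore] -/
theorem blowDown_c_zero (n : N) : D.blowDown (D.c (n, 0)) = D.centre (circleQuotientMk n) := by
  rw [D.blowDown_of_mem_band ⟨(n, 0), D.zero_mem_band n, rfl⟩, centre_apply]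
  congr 1
  apply Subtype.ext
  rw [D.coe_bandB_c (D.zero_mem_band n), coe_zeroB, cutZero_mk, cutSlice_apply, Complex.ofReal_zero]

/-- The neighbourhood `U = V ∪ c(band)` of `closure V`. [folklore] -/
def nbhd : Set M := (D.V : Set M) ∪ D.c '' D.band

omit [T2Space N] [Nonempty N] in
/-- `U` is open. [folklore] -/
theorem isOpen_nbhd : IsOpen D.nbhd := D.V.isOpen.union D.isOpen_image_band

omit [IsManifold (𝓡 4) ∞ M] [IsManifold (𝓡 3) ∞ N] [T2Space N] [Nonempty N] in
/-- `closure V ⊆ U`. [folklore] -/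
theorem closure_subset_nbhd : closure (D.V : Set M) ⊆ D.nbhd := by
  intro x hx
  rcases D.closure_subset hx with h | ⟨⟨n, t⟩, ⟨-, ht⟩, rfl⟩
  · exact Or.inl h
  · rw [mem_singleton_iff] at ht
    subst ht
    exact Or.inr ⟨(n, 0), D.zero_mem_band n, rfl⟩

omit [T2Space N] in
/-- `bandParam` is `C^∞` on the band image. [folklore] -/
theorem contMDiffOn_bandParam :
    ContMDiffOn (𝓡 4) ((𝓡 3).prod 𝓘(ℝ, ℝ)) ∞ D.bandParam (D.c '' D.band) :=
  D.contMDiffOn_cInv.congr fun _ hx => D.bandParam_of_mem hx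

/-- `bandB` is `C^∞` on the band image. [folklore] -/
theorem contMDiffOn_bandB : letI := D.csB; ContMDiffOn (𝓡 4) (𝓡 (3 + 1)) ∞ D.bandB (D.c '' D.band) := by
  letI := D.csB
  haveI := isManifold_cutSpace D.smooth_act D.free_act
  have h : ContMDiffOn (𝓡 4) (𝓡 (3 + 1)) ∞ (fun x => (D.bandB x : CutSpace 3 N)) (D.c '' D.band) :=
    (contMDiff_cutSlice D.smooth_act D.free_act).comp_contMDiffOn D.contMDiffOn_bandParam
  intro x hx
  exact (ContMDiffWithinAt.subtypeVal_comp_iff D.B D.bandB _ x).1 (h x hx)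

/-- **The blow-down is `C^∞` on `U = V ∪ c(band)`.** [cite: CannasdasilvaGuilleminPires2010, Def. 2.13] -/
theorem contMDiffOn_blowDown : ContMDiffOn (𝓡 4) (𝓡 4) ∞ D.blowDown D.nbhd := by
  letI := D.csB
  haveI := isManifold_cutSpace D.smooth_act D.free_act
  have hV : ContMDiffOn (𝓡 4) (𝓡 4) ∞ D.blowDown (D.V : Set M) :=
    (D.contMDiff_inV.comp_contMDiffOn D.contMDiffOn_mkV).congr fun x hx => D.blowDown_eq_inV_mkV hx
  have hB : ContMDiffOn (𝓡 4) (𝓡 4) ∞ D.blowDown (D.c '' D.band) :=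
    (D.contMDiff_inB.comp_contMDiffOn D.contMDiffOn_bandB).congr fun x hx => D.blowDown_of_mem_band hx
  intro x hx
  rcases hx with hx | hx
  · exact (hV.contMDiffAt (D.V.isOpen.mem_nhds hx)).contMDiffWithinAt
  · exact (hB.contMDiffAt (D.isOpen_image_band.mem_nhds hx)).contMDiffWithinAt

/-- The smoothness clause of the fact: an open `U ⊇ closure V` on which the blow-down is `C^∞`.
[cite: CannasdasilvaGuilleminPires2010, Def. 2.13] -/
theorem exists_nbhd_contMDiffOn_blowDown :
    ∃ U : Set M, IsOpen U ∧ closure (D.V : Set M) ⊆ U ∧ ContMDiffOn (𝓡 4) (𝓡 4) ∞ D.blowDown U :=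
  ⟨D.nbhd, D.isOpen_nbhd, D.closure_subset_nbhd, D.contMDiffOn_blowDown⟩

/-- **The blow-down is injective on `V`.** [folklore] -/
theorem injOn_blowDown : InjOn D.blowDown (D.V : Set M) := by
  intro x hx y hy h
  rw [D.blowDown_of_mem_V hx, D.blowDown_of_mem_V hy] at h
  exact congrArg Subtype.val (D.inV_injective h)

/-- **The image of the fold**: `blowDown '' c (N × {0}) = range centre`. [folklore] -/
theorem image_blowDown_zero : D.blowDown '' (D.c '' (univ ×ˢ {0})) = range D.centre := by
  ext p
  constructor
  · rintro ⟨_, ⟨⟨n, t⟩, ⟨-, ht⟩, rfl⟩, rfl⟩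
    rw [mem_singleton_iff] at ht
    subst ht
    exact ⟨circleQuotientMk n, (D.blowDown_c_zero n).symm⟩
  · rintro ⟨y, rfl⟩
    obtain ⟨n, rfl⟩ := circleQuotientMk_surjective y
    exact ⟨D.c (n, 0), ⟨(n, 0), ⟨mem_univ _, rfl⟩, rfl⟩, D.blowDown_c_zero n⟩

/-- **The image of `V`**: `blowDown '' V = (range centre)ᶜ`. [cite: CannasdasilvaGuilleminPires2010, Prop. 2.8] -/
theorem image_blowDown_V : D.blowDown '' (D.V : Set M) = (range D.centre)ᶜ := by
  ext p
  constructor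
  · rintro ⟨x, hx, rfl⟩ ⟨y, hy⟩
    rw [D.blowDown_of_mem_V hx] at hy
    exact D.centre_ne_inV y _ hy
  · intro hp
    rcases D.exists_inV_or_inB p with ⟨a, rfl⟩ | ⟨b, rfl⟩
    · exact ⟨a, a.2, D.blowDown_of_mem_V a.2⟩
    · by_cases hb : b ∈ D.glueTarget
      · refine ⟨(D.unglueFun b : M), (D.unglueFun b).2, ?_⟩
        rw [D.blowDown_of_mem_V (D.unglueFun b).2]
        exact D.inV_unglueFun hb
      · obtain ⟨y, rfl⟩ := D.exists_zeroB_of_not_mem_target hb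
        exact absurd ⟨y, rfl⟩ hp

/-! ### The differential on `V` -/

/-- `d(inV)` has a left inverse. [folklore] -/
theorem mfderiv_invFun_inV_apply (a : D.V) (u : TangentSpace (𝓡 4) a) :
    mfderiv (𝓡 4) (𝓡 4) (Function.invFun D.inV) (D.inV a) (mfderiv (𝓡 4) (𝓡 4) D.inV a u) = u := by
  have hid := mfderiv_invFun_comp_mfderiv D.inV_injective D.contMDiff_inV D.contMDiffAt_invFun_inV a
  exact congrArg (fun L => L u) hid

/-- **`d(inV)` is bijective** (`inV` is an open embedding with smooth inverse). [folklore] -/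
theorem bijective_mfderiv_inV (a : D.V) : Bijective (mfderiv (𝓡 4) (𝓡 4) D.inV a) := by
  constructor
  · intro u u' h
    rw [← D.mfderiv_invFun_inV_apply a u, ← D.mfderiv_invFun_inV_apply a u', h]
  · intro W
    refine ⟨mfderiv (𝓡 4) (𝓡 4) (Function.invFun D.inV) (D.inV a) W, ?_⟩
    have hid := mfderiv_comp_mfderiv_invFun D.inV_injective D.isOpenEmbedding_inV.isOpenMap
      D.contMDiff_inV D.contMDiffAt_invFun_inV a
    exact congrArg (fun L => L W) hid

/-- **The differential of the blow-down on `V`** is that of `inV`. [folklore] -/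
theorem mfderiv_blowDown_of_mem_V {x : M} (hx : x ∈ (D.V : Set M)) :
    mfderiv (𝓡 4) (𝓡 4) D.blowDown x = mfderiv (𝓡 4) (𝓡 4) D.inV ⟨x, hx⟩ := by
  have hev : D.blowDown =ᶠ[𝓝 x] (D.inV ∘ D.mkV) := by
    filter_upwards [D.V.isOpen.mem_nhds hx] with y hy
    exact D.blowDown_eq_inV_mkV hy
  have hd : MDifferentiableAt (𝓡 4) (𝓡 4) D.mkV x :=
    (D.contMDiffOn_mkV.contMDiffAt (D.V.isOpen.mem_nhds hx)).mdifferentiableAt (by simp)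
  have hi : MDifferentiableAt (𝓡 4) (𝓡 4) D.inV (D.mkV x) :=
    (D.contMDiff_inV _).mdifferentiableAt (by simp)
  rw [hev.mfderiv_eq, mfderiv_comp x hi hd, D.mfderiv_mkV hx]
  rw [D.mkV_of_mem hx]
  rfl

/-- **The differential of the blow-down is bijective on `V`.**
[cite: CannasdasilvaGuilleminPires2010, Prop. 2.8] -/
theorem bijective_mfderiv_blowDown {x : M} (hx : x ∈ (D.V : Set M)) :
    Bijective (mfderiv (𝓡 4) (𝓡 4) D.blowDown x) := by
  rw [D.mfderiv_blowDown_of_mem_V hx]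
  exact D.bijective_mfderiv_inV ⟨x, hx⟩

/-- **The blow-down pulls the glued form back to `s` on `V`.**
[cite: CannasdasilvaGuilleminPires2010, Prop. 2.8] -/
theorem pieceForm_blowDown_apply {x : M} (hx : x ∈ (D.V : Set M)) (v : Fin 2 → TangentSpace (𝓡 4) x) :
    D.pieceForm (D.blowDown x) (fun i => mfderiv (𝓡 4) (𝓡 4) D.blowDown x (v i)) = D.s x v := by
  rw [MForm.apply_congr_point' D.pieceForm (D.blowDown_of_mem_V hx)]
  have hfd := D.mfderiv_blowDown_of_mem_V hx
  have hv : (fun i => mfderiv (𝓡 4) (𝓡 4) D.blowDown x (v i)) =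
      fun i => mfderiv (𝓡 4) (𝓡 4) D.inV ⟨x, hx⟩ (v i) := by
    funext i; exact congrArg (fun L => L (v i)) hfd
  rw [hv]
  exact D.pieceForm_inV_apply ⟨x, hx⟩ v

end CutCollarData

end Literature.Geometry.Symplectic

end
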